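import Mathlib
import Literature.Analysis.FluidPDE.Tao2016AveragedNS.BoundedEternalSolutions
import Summits.NavierStokesRegularity.NavierStokesRegularity.Theorems.TaoLadderRungTwoBreakNoSurvivingEternalViscBddOneUpwardFluxVisc
import HarnessLib

/-!
# The THROUGHPUT RECURSION WITH A BACKSCATTER BUDGET — helper toward K1ᵛ(1)
# `TaoLadderRungTwoBreak.NoSurvivingEternalViscBddOne` (stmt-NavierStokesRegularity-20419), any `ν̂ ≥ 0`, no sign assumption

MODEL lattice ODEs only (Tao 2016 §4, §6.4; cell vocabulary `IsEternalVisc`, `UniformBound`, `physEnergy`, `physFlux`);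
nothing here is a statement about the Navier–Stokes equations; no summit, crux or rung LEAF is proved
(`--supports stmt-NavierStokesRegularity-20419`).  Sequel to `…UpwardFluxVisc` / `…UpwardFluxRung` (throughput recursion and
logarithmic action floor in the SIGN-COHERENT class).  Here the sign assumption is REMOVED and replaced by a budget: for EVERY uniformly
bounded admissible eternal solution (any `ν̂ ≥ 0`) of a cancelling table, with `Φ_j = ∫_ℝ F_j` the NET traffic of the bond `j → j+1`,
`B_j ≥ ∫ b_j` for any continuous integrable majorant `b_j ≥ max(−F_j, 0)` of its BACKSCATTER, `κ = 2C_AΛ⁻¹·a`, `a ≥ ∫‖W_{k+2}‖`: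

* `heldEnergy_ge_retention_backscatter` — `G_{k+1}(σ) ≥ e^{−κ}·G_{k+1}(σ⋆) − ∫_{σ⋆}^{σ} b_k` (the held energy
  `G_{k+1} = ∫_{-∞}^{σ}F_k − ∫_{-∞}^{σ}F_{k+1} ≥ E_{k+1}` leaks only through the bond above or by backscatter below);
* `throughput_succ_le_backscatter` — **`Φ_{k+1} ≤ (1 − e^{−κ}/(1+κ))·Φ_k + B_k + (e^{−κ}/(1+κ))·B_{k+1}`**: the sign-coherent
  recursion is STABLE under backscatter, with an additive error of one backscatter budget per adjacent bond;
* `throughput_le_pow_backscatter` — with a uniform action budget `M` (`κ = 2C_AΛ⁻¹M`, `ρ = 1 − e^{−κ}/(1+κ)`) and a RELATIVE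
  backscatter budget `B_j ≤ β·Φ_j` (`0 ≤ β < 1`): `Φ_{k₀+n} ≤ ((ρ+β)/(1−β))ⁿ·Φ_{k₀}`;
* `not_survivingFwd_of_backscatterBudget` — hence `(1+ε₀)(ρ+β) < 1−β ⟹` NOT forward (S₁)-surviving.

READING for the census of ⟨20419⟩ (quantifying «backscatter is the only way past the logarithmic action floor»): a surviving uniformly
bounded admissible eternal solution at small `ε₀` must have, on infinitely many bonds, EITHER action `≳ log(1/(ε₀+β))` OR relative
backscatter `β ≳ e^{−κ}/(1+κ)` — at bounded action the energy must be handed back down and re-sent through a fixed fraction of the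
bonds' traffic.  HONEST LABEL: a rung; (ρ0), (ρ+), ⟨20419⟩ and every NS statement remain OPEN.
-/

noncomputable section

-- the summit and its single sub-problem share the name (CONVENTIONS §1)
set_option linter.dupNamespace false

namespace Summit.NavierStokesRegularity.NavierStokesRegularity.Theorems.NoSurvivingEternalViscBddOne.UpwardFlux

open Set Filter Topology MeasureTheory
open scoped RealInnerProductSpace
open Literature.Analysis.FluidPDE Literature.Analysis.FluidPDE.TaoCascade
open Summit.NavierStokesRegularity.NavierStokesRegularity.Theorems.NoSurvivingEternalViscBddOne.SmallAction
  (continuous_physEnergy continuous_physFlux tendsto_physEnergy_atBot exists_physEnergy_le viscCoef_nonneg)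

variable {m : ℕ} {ε₀ νh : ℝ} {α : Fin m → Fin m → Fin m → ℤ × ℤ × ℤ → ℝ} {W : ℤ → ℝ → Em m}

/-! ## Cumulative throughputs of a signed flux -/

/-- The cumulative throughput `σ ↦ ∫_{-∞}^{σ}F` of an integrable flux tends to the total one `∫_ℝ F`. [folklore] -/
theorem tendsto_integral_Iic_atTop {F : ℝ → ℝ} (hF : Integrable F) :
    Tendsto (fun σ : ℝ => ∫ s in Iic σ, F s) atTop (𝓝 (∫ s, F s)) :=
  (aecover_Iic tendsto_id).integral_tendsto_of_countably_generated hF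

/-- With a non-negative integrable majorant `b ≥ −F` of the backscatter: `∫_{-∞}^{σ}F ≤ ∫_ℝ F + ∫_ℝ b` for every `σ`. [folklore] -/
theorem integral_Iic_le_integral_add {F b : ℝ → ℝ} (hF : Integrable F) (hb : Integrable b) (hb0 : ∀ s, 0 ≤ b s)
    (hbF : ∀ s, -F s ≤ b s) (σ : ℝ) : (∫ s in Iic σ, F s) ≤ (∫ s, F s) + ∫ s, b s := by
  have hsplit := integral_add_compl (μ := volume) (measurableSet_Iic : MeasurableSet (Iic σ)) hF
  rw [compl_Iic] at hsplit
  have h1 : -(∫ s in Ioi σ, F s) ≤ ∫ s in Ioi σ, b s := by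
    rw [← integral_neg]
    exact setIntegral_mono hF.neg.integrableOn hb.integrableOn fun s => hbF s
  have h2 : (∫ s in Ioi σ, b s) ≤ ∫ s, b s := setIntegral_le_integral hb (Eventually.of_forall hb0)
  linarith

/-! ## Retention with backscatter -/

/-- **Retention of the held energy with a backscatter leak** (any `ν̂ ≥ 0`, NO sign assumption).  With `b ≥ max(−F_k, 0)` a continuous
majorant of the backscatter through the bond below, `Θ ≥ ∫_{σ⋆}^{σ}2C_AΛ⁻¹‖W_{k+2}‖` and `β ≥ ∫_{σ⋆}^{σ} b`:
`e^{−Θ}·G_{k+1}(σ⋆) − β ≤ G_{k+1}(σ)` — the held energy `G_{k+1} = ∫_{-∞}^{σ}F_k − ∫_{-∞}^{σ}F_{k+1}` leaks only through the bond above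
(relative rate `≤ 2C_AΛ⁻¹‖W_{k+2}‖`) or back down through the bond below (at most `b`).
[cite: Tao2016AveragedNS, §4 Lemma 4.1 (4.8)–(4.10) with (4.3) and the viscous equation before Thm. 4.2, §6.4; this file] -/
theorem heldEnergy_ge_retention_backscatter (hε : 0 < ε₀) (hW : IsEternalVisc ε₀ νh α W) (hc : IsCancellingCoeff α)
    (hU : UniformBound W) (k : ℤ) {σs σ : ℝ} (hle : σs ≤ σ) {b : ℝ → ℝ} (cb : Continuous b)
    (hb0 : ∀ s, 0 ≤ b s) (hbF : ∀ s, -physFlux ε₀ α W k s ≤ b s)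
    {Θ : ℝ} (hΘ : ∫ s in σs..σ, 2 * fluxConst α * (bigLam ε₀)⁻¹ * ‖W (k + 2) s‖ ≤ Θ)
    {β : ℝ} (hβ : ∫ s in σs..σ, b s ≤ β) :
    Real.exp (-Θ) * ((∫ s in Iic σs, physFlux ε₀ α W k s) - ∫ s in Iic σs, physFlux ε₀ α W (k + 1) s) - β
      ≤ (∫ s in Iic σ, physFlux ε₀ α W k s) - ∫ s in Iic σ, physFlux ε₀ α W (k + 1) s := by
  set κ₀ := 2 * fluxConst α * (bigLam ε₀)⁻¹ with hκ₀
  have hΛ : 0 < bigLam ε₀ := bigLam_pos (by linarith)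
  have hκ₀nn : 0 ≤ κ₀ := by have := fluxConst_nonneg α; positivity
  have hFk := integrable_physFlux hε hW hc hU k
  have hFk1 := integrable_physFlux hε hW hc hU (k + 1)
  have cFk := continuous_physFlux hW hc k
  have cFk1 := continuous_physFlux hW hc (k + 1)
  have cWk2 : Continuous (W (k + 2)) := continuous_iff_continuousAt.2 fun s => (hW.law (k + 2) s).continuousAt
  set G : ℝ → ℝ := fun u => (∫ s in Iic u, physFlux ε₀ α W k s) - ∫ s in Iic u, physFlux ε₀ α W (k + 1) s with hG
  have hGderiv : ∀ u, HasDerivAt G (physFlux ε₀ α W k u - physFlux ε₀ α W (k + 1) u) u := fun u =>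
    (hasDerivAt_integral_Iic hFk cFk σs u).sub (hasDerivAt_integral_Iic hFk1 cFk1 σs u)
  have cG : Continuous G := continuous_iff_continuousAt.2 fun u => (hGderiv u).continuousAt
  have hEG : ∀ u, physEnergy ε₀ W (k + 1) u ≤ G u := fun u => physEnergy_le_heldEnergy hε hW hc hU k u
  have hGnn : ∀ u, 0 ≤ G u := fun u => (physEnergy_nonneg ε₀ W (k + 1) u).trans (hEG u)
  set θ : ℝ → ℝ := fun s => κ₀ * ‖W (k + 2) s‖ with hθ
  have cθ : Continuous θ := by simp only [hθ]; fun_prop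
  have hθnn : ∀ s, 0 ≤ θ s := fun s => mul_nonneg hκ₀nn (norm_nonneg _)
  set P : ℝ → ℝ := fun u => ∫ x in σs..u, θ x with hP
  have hPderiv : ∀ u, HasDerivAt P (θ u) u := fun u => (cθ.integral_hasStrictDerivAt σs u).hasDerivAt
  have cP : Continuous P := continuous_iff_continuousAt.2 fun u => (hPderiv u).continuousAt
  have hP0 : P σs = 0 := by simp [hP]
  have hPσ : P σ ≤ Θ := hΘ
  have hPmono : ∀ s ∈ Icc σs σ, P s ≤ P σ := by
    intro s hs
    have h := intervalIntegral.integral_mono_interval (μ := volume) (f := θ) (c := σs) (d := σ) (a := σs)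
      (b := s) le_rfl hs.1 hs.2 (Eventually.of_forall fun x => hθnn x) (cθ.intervalIntegrable _ _)
    simpa [hP] using h
  set Ψ : ℝ → ℝ := fun s => Real.exp (P s) * G s with hΨ
  set Ψ' : ℝ → ℝ := fun s => Real.exp (P s) * θ s * G s
      + Real.exp (P s) * (physFlux ε₀ α W k s - physFlux ε₀ α W (k + 1) s) with hΨ'
  have hΨderiv : ∀ s, HasDerivAt Ψ (Ψ' s) s := by
    intro s
    have h1 : HasDerivAt (fun u => Real.exp (P u)) (Real.exp (P s) * θ s) s := (hPderiv s).exp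
    exact h1.mul (hGderiv s)
  have cΨ' : Continuous Ψ' := by
    have : Continuous fun s => Real.exp (P s) := cP.rexp
    simp only [hΨ']; fun_prop
  set L : ℝ → ℝ := fun s => -(Real.exp (P σ) * b s) with hL
  have cL : Continuous L := by simp only [hL]; fun_prop
  have hlow : ∀ s ∈ Icc σs σ, L s ≤ Ψ' s := by
    intro s hs
    have heP : 0 < Real.exp (P s) := Real.exp_pos _
    have hePle : Real.exp (P s) ≤ Real.exp (P σ) := Real.exp_le_exp.2 (hPmono s hs)
    have hFk1le : physFlux ε₀ α W (k + 1) s ≤ κ₀ * ‖W (k + 2) s‖ * physEnergy ε₀ W (k + 1) s := by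
      have := (le_abs_self _).trans (abs_physFlux_le hε hc W (k + 1) s)
      rw [show k + 1 + 1 = k + 2 by ring] at this; rw [hκ₀]; linarith
    have hFk1G : physFlux ε₀ α W (k + 1) s ≤ θ s * G s :=
      hFk1le.trans (mul_le_mul_of_nonneg_left (hEG s) (hθnn s))
    have hsum : -b s ≤ θ s * G s + (physFlux ε₀ α W k s - physFlux ε₀ α W (k + 1) s) := by
      linarith [hbF s]
    have e1 : Ψ' s = Real.exp (P s) * (θ s * G s + (physFlux ε₀ α W k s - physFlux ε₀ α W (k + 1) s)) := by
      simp only [hΨ']; ring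
    rw [e1]
    have h3 := mul_le_mul_of_nonneg_left hsum heP.le
    have h4 : L s ≤ Real.exp (P s) * (-b s) := by simp only [hL]; nlinarith [hb0 s]
    exact h4.trans h3
  have hftc : ∫ s in σs..σ, Ψ' s = Ψ σ - Ψ σs :=
    intervalIntegral.integral_eq_sub_of_hasDerivAt (fun s _ => hΨderiv s) (cΨ'.intervalIntegrable _ _)
  have hmono : ∫ s in σs..σ, L s ≤ ∫ s in σs..σ, Ψ' s :=
    intervalIntegral.integral_mono_on hle (cL.intervalIntegrable _ _) (cΨ'.intervalIntegrable _ _) hlow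
  have hLint : ∫ s in σs..σ, L s = -(Real.exp (P σ) * ∫ s in σs..σ, b s) := by
    simp only [hL]; rw [intervalIntegral.integral_neg, intervalIntegral.integral_const_mul]
  have hLge : -(Real.exp (P σ) * β) ≤ ∫ s in σs..σ, L s := by
    rw [hLint, neg_le_neg_iff]
    exact mul_le_mul_of_nonneg_left hβ (Real.exp_pos _).le
  have hΨs : Ψ σs = G σs := by simp [hΨ, hP0]
  have hkey : G σs - Real.exp (P σ) * β ≤ Real.exp (P σ) * G σ := by
    rw [← show Ψ σ = Real.exp (P σ) * G σ from rfl, ← hΨs]; linarith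
  have e1 : Real.exp (-P σ) * Real.exp (P σ) = 1 := by rw [← Real.exp_add, neg_add_cancel, Real.exp_zero]
  have hdiv : Real.exp (-P σ) * G σs - β ≤ G σ := by
    have h := mul_le_mul_of_nonneg_left hkey (Real.exp_pos (-P σ)).le
    have e2 : Real.exp (-P σ) * (Real.exp (P σ) * G σ) = G σ := by rw [← mul_assoc, e1, one_mul]
    have e3 : Real.exp (-P σ) * (G σs - Real.exp (P σ) * β) = Real.exp (-P σ) * G σs - β := by
      rw [mul_sub, ← mul_assoc, e1, one_mul]
    rw [e2, e3] at h
    exact h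
  have hexp : Real.exp (-Θ) ≤ Real.exp (-P σ) := Real.exp_le_exp.2 (by linarith)
  show Real.exp (-Θ) * G σs - β ≤ G σ
  have := mul_le_mul_of_nonneg_right hexp (hGnn σs)
  linarith

/-! ## The throughput recursion with a backscatter budget -/

/-- **THE THROUGHPUT RECURSION WITH BACKSCATTER** (any `ν̂ ≥ 0`, no sign assumption).  With `Φ_j = ∫_ℝ F_j` (net traffic),
`B_k ≥ ∫ b_k`, `B_{k+1} ≥ ∫ b_{k+1}` for non-negative integrable majorants `b_k ≥ −F_k` (continuous), `b_{k+1} ≥ −F_{k+1}` of the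
backscatter through the two bonds, `κ = 2C_AΛ⁻¹a`, `a ≥ ∫‖W_{k+2}‖`:
`Φ_{k+1} ≤ (1 − e^{−κ}/(1+κ))·Φ_k + B_k + (e^{−κ}/(1+κ))·B_{k+1}`.
[cite: Tao2016AveragedNS, §4 Lemma 4.1 (4.8)–(4.10) with (4.3) and the viscous equation before Thm. 4.2, §6.4; this file] -/
theorem throughput_succ_le_backscatter (hε : 0 < ε₀) (hW : IsEternalVisc ε₀ νh α W) (hc : IsCancellingCoeff α)
    (hU : UniformBound W) (k : ℤ) {a : ℝ} (ha : ∫ s, ‖W (k + 2) s‖ ≤ a)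
    {b₀ : ℝ → ℝ} (cb₀ : Continuous b₀) (ib₀ : Integrable b₀) (hb₀0 : ∀ s, 0 ≤ b₀ s)
    (hb₀F : ∀ s, -physFlux ε₀ α W k s ≤ b₀ s) {B₀ : ℝ} (hB₀ : ∫ s, b₀ s ≤ B₀)
    {b₁ : ℝ → ℝ} (ib₁ : Integrable b₁) (hb₁0 : ∀ s, 0 ≤ b₁ s)
    (hb₁F : ∀ s, -physFlux ε₀ α W (k + 1) s ≤ b₁ s) {B₁ : ℝ} (hB₁ : ∫ s, b₁ s ≤ B₁) :
    (∫ s, physFlux ε₀ α W (k + 1) s)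
      ≤ (1 - Real.exp (-(2 * fluxConst α * (bigLam ε₀)⁻¹ * a)) / (1 + 2 * fluxConst α * (bigLam ε₀)⁻¹ * a))
          * (∫ s, physFlux ε₀ α W k s) + B₀
        + Real.exp (-(2 * fluxConst α * (bigLam ε₀)⁻¹ * a)) / (1 + 2 * fluxConst α * (bigLam ε₀)⁻¹ * a) * B₁ := by
  set κ₀ := 2 * fluxConst α * (bigLam ε₀)⁻¹ with hκ₀
  have hΛ : 0 < bigLam ε₀ := bigLam_pos (by linarith)
  have hκ₀nn : 0 ≤ κ₀ := by have := fluxConst_nonneg α; positivity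
  obtain ⟨Mact, hMact⟩ := hW.action
  have hint2 : Integrable (fun s => ‖W (k + 2) s‖) := (hMact (k + 2)).1
  have ha0 : 0 ≤ a := le_trans (integral_nonneg fun s => norm_nonneg _) ha
  set κ := κ₀ * a with hκdef
  have hκnn : 0 ≤ κ := mul_nonneg hκ₀nn ha0
  have h1κ : 0 < 1 + κ := by linarith
  set q := Real.exp (-κ) with hqdef
  have hq0 : 0 < q := Real.exp_pos _
  have hq1 : q ≤ 1 := Real.exp_le_one_iff.2 (by linarith)
  have hFk := integrable_physFlux hε hW hc hU k
  have hFk1 := integrable_physFlux hε hW hc hU (k + 1)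
  set x := ∫ s, physFlux ε₀ α W k s with hx
  set y := ∫ s, physFlux ε₀ α W (k + 1) s with hy
  have hB₀0 : 0 ≤ B₀ := (integral_nonneg hb₀0).trans hB₀
  have hB₁0 : 0 ≤ B₁ := (integral_nonneg hb₁0).trans hB₁
  -- the held energy
  set G : ℝ → ℝ := fun u => (∫ s in Iic u, physFlux ε₀ α W k s) - ∫ s in Iic u, physFlux ε₀ α W (k + 1) s with hG
  have hEG : ∀ u, physEnergy ε₀ W (k + 1) u ≤ G u := fun u => physEnergy_le_heldEnergy hε hW hc hU k u
  have hGnn : ∀ u, 0 ≤ G u := fun u => (physEnergy_nonneg ε₀ W (k + 1) u).trans (hEG u)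
  have hTk := tendsto_integral_Iic_atTop hFk
  have hTk1 := tendsto_integral_Iic_atTop hFk1
  have hTG : Tendsto G atTop (𝓝 (x - y)) := hTk.sub hTk1
  -- retention: `q G(σ⋆) − B₀ ≤ G(σ)` for `σ⋆ ≤ σ`
  have hret : ∀ σs σ, σs ≤ σ → q * G σs - B₀ ≤ G σ := by
    intro σs σ hle
    refine heldEnergy_ge_retention_backscatter hε hW hc hU k hle cb₀ hb₀0 hb₀F ?_ ?_
    · rw [intervalIntegral.integral_const_mul]
      refine mul_le_mul_of_nonneg_left ?_ hκ₀nn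
      rw [intervalIntegral.integral_of_le hle]
      exact (setIntegral_le_integral hint2 (Eventually.of_forall fun s => norm_nonneg _)).trans ha
    · rw [intervalIntegral.integral_of_le hle]
      exact (setIntegral_le_integral ib₀ (Eventually.of_forall hb₀0)).trans hB₀
  -- Step A: `q G(σ⋆) − B₀ ≤ x − y` (let `σ → ∞`)
  have hA : ∀ σs, q * G σs - B₀ ≤ x - y := fun σs =>
    ge_of_tendsto hTG (eventually_atTop.2 ⟨σs, fun σ hσ => hret σs σ hσ⟩)
  -- the common bound `P' = (x − y + B₀)/q` of the held energy
  set P' := (x - y + B₀) / q with hP'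
  have hqP' : q * P' = x - y + B₀ := by rw [hP']; field_simp
  have hGP' : ∀ σ, G σ ≤ P' := by
    intro σ; rw [hP', le_div_iff₀ hq0]; linarith [hA σ]
  have hP'0 : 0 ≤ P' := (hGnn 0).trans (hGP' 0)
  -- Step C: `x ≤ P' + y + B₁`
  have hIk1 : ∀ σ, (∫ s in Iic σ, physFlux ε₀ α W (k + 1) s) ≤ y + B₁ := fun σ =>
    (integral_Iic_le_integral_add hFk1 ib₁ hb₁0 hb₁F σ).trans (by linarith)
  have hC : x ≤ P' + y + B₁ := by
    refine le_of_tendsto' hTk fun σ => ?_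
    have h1 : (∫ s in Iic σ, physFlux ε₀ α W k s) = G σ + ∫ s in Iic σ, physFlux ε₀ α W (k + 1) s := by
      simp only [hG]; ring
    rw [h1]
    linarith [hGP' σ, hIk1 σ]
  -- Step D: `y ≤ κ P'`
  have hD : y ≤ κ * P' := by
    have hpt : ∀ s, physFlux ε₀ α W (k + 1) s ≤ κ₀ * P' * ‖W (k + 2) s‖ := by
      intro s
      have h := (le_abs_self _).trans (abs_physFlux_le hε hc W (k + 1) s)
      rw [show k + 1 + 1 = k + 2 by ring] at h
      calc physFlux ε₀ α W (k + 1) s ≤ 2 * fluxConst α * (bigLam ε₀)⁻¹ * ‖W (k + 2) s‖ * physEnergy ε₀ W (k + 1) s := h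
        _ ≤ 2 * fluxConst α * (bigLam ε₀)⁻¹ * ‖W (k + 2) s‖ * P' :=
            mul_le_mul_of_nonneg_left ((hEG s).trans (hGP' s)) (mul_nonneg hκ₀nn (norm_nonneg _))
        _ = κ₀ * P' * ‖W (k + 2) s‖ := by rw [hκ₀]; ring
    calc y ≤ ∫ s, κ₀ * P' * ‖W (k + 2) s‖ := integral_mono hFk1 (hint2.const_mul _) hpt
      _ = κ₀ * P' * ∫ s, ‖W (k + 2) s‖ := integral_const_mul _ _
      _ ≤ κ₀ * P' * a := mul_le_mul_of_nonneg_left ha (mul_nonneg hκ₀nn hP'0)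
      _ = κ * P' := by rw [hκdef]; ring
  -- combine: `x − B₁ ≤ (1+κ) P'`, i.e. `(q/(1+κ))(x − B₁) ≤ q P' = x − y + B₀`
  have h1 : x - B₁ ≤ (1 + κ) * P' := by linarith
  have h2 : q / (1 + κ) * (x - B₁) ≤ x - y + B₀ := by
    rw [← hqP', div_mul_eq_mul_div, div_le_iff₀ h1κ]
    nlinarith
  show y ≤ (1 - q / (1 + κ)) * x + B₀ + q / (1 + κ) * B₁
  linarith

/-- **The throughput chain under a RELATIVE backscatter budget** (any `ν̂ ≥ 0`).  With a uniform action budget `∫‖W_n‖ ≤ M`,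
`ρ = 1 − e^{−κ}/(1+κ)`, `κ = 2C_AΛ⁻¹M`, and backscatter majorants `b_j ≥ max(−F_j, 0)` (continuous, integrable) with
`∫ b_j ≤ β·Φ_j` for every bond (`0 ≤ β < 1`): `Φ_{k₀+n} ≤ ((ρ+β)/(1−β))ⁿ·Φ_{k₀}`.
[cite: Tao2016AveragedNS, §4 Lemma 4.1 (4.8)–(4.10), §6.4; this file] -/
theorem throughput_le_pow_backscatter (hε : 0 < ε₀) (hW : IsEternalVisc ε₀ νh α W) (hc : IsCancellingCoeff α)
    (hU : UniformBound W) {M : ℝ} (hM : ∀ n, ∫ s, ‖W n s‖ ≤ M)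
    {b : ℤ → ℝ → ℝ} (cb : ∀ j, Continuous (b j)) (ib : ∀ j, Integrable (b j)) (hb0 : ∀ j s, 0 ≤ b j s)
    (hbF : ∀ j s, -physFlux ε₀ α W j s ≤ b j s) {β : ℝ} (hβ0 : 0 ≤ β) (hβ1 : β < 1)
    (hB : ∀ j, ∫ s, b j s ≤ β * ∫ s, physFlux ε₀ α W j s) (k₀ : ℤ) :
    ∀ n : ℕ, (∫ s, physFlux ε₀ α W (k₀ + n) s)
      ≤ ((1 - Real.exp (-(2 * fluxConst α * (bigLam ε₀)⁻¹ * M)) / (1 + 2 * fluxConst α * (bigLam ε₀)⁻¹ * M) + β)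
          / (1 - β)) ^ n * ∫ s, physFlux ε₀ α W k₀ s := by
  set κ := 2 * fluxConst α * (bigLam ε₀)⁻¹ * M with hκ
  set ρ := 1 - Real.exp (-κ) / (1 + κ) with hρ
  have hM0 : 0 ≤ M := le_trans (integral_nonneg fun s => norm_nonneg (W 0 s)) (hM 0)
  have hκnn : 0 ≤ κ := by
    have := fluxConst_nonneg α; have := (bigLam_pos (by linarith : (-1 : ℝ) < ε₀)).le; positivity
  have hρ0 : 0 ≤ ρ := (ratio_bounds hκnn).1
  have h1κ : 0 < 1 + κ := by linarith
  have hq1 : Real.exp (-κ) / (1 + κ) ≤ 1 := by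
    rw [div_le_one h1κ]; have := Real.exp_le_one_iff.2 (by linarith : -κ ≤ 0); linarith
  have hq0 : 0 ≤ Real.exp (-κ) / (1 + κ) := div_nonneg (Real.exp_pos _).le h1κ.le
  have h1β : 0 < 1 - β := by linarith
  set r := (ρ + β) / (1 - β) with hr
  have hr0 : 0 ≤ r := div_nonneg (by linarith) h1β.le
  -- one step: `Φ_{k+1} ≤ r Φ_k`
  have hstep : ∀ k : ℤ, (∫ s, physFlux ε₀ α W (k + 1) s) ≤ r * ∫ s, physFlux ε₀ α W k s := by
    intro k
    have h := throughput_succ_le_backscatter hε hW hc hU k (hM (k + 2)) (cb k) (ib k) (hb0 k) (hbF k) (hB k)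
      (ib (k + 1)) (hb0 (k + 1)) (hbF (k + 1)) (hB (k + 1))
    set x := ∫ s, physFlux ε₀ α W k s
    set y := ∫ s, physFlux ε₀ α W (k + 1) s
    have hBy0 : 0 ≤ β * y := (integral_nonneg (hb0 (k + 1))).trans (hB (k + 1))
    have h2 : y ≤ ρ * x + β * x + β * y := by
      have := mul_le_mul_of_nonneg_right hq1 hBy0
      rw [one_mul] at this
      have h' : y ≤ ρ * x + β * x + Real.exp (-κ) / (1 + κ) * (β * y) := h
      linarith
    have h3 : (1 - β) * y ≤ (ρ + β) * x := by linarith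
    rw [hr, div_mul_eq_mul_div, le_div_iff₀ h1β]
    linarith
  intro n
  induction n with
  | zero => simp
  | succ n ih =>
    have e1 : k₀ + ((n + 1 : ℕ) : ℤ) = k₀ + n + 1 := by push_cast; ring
    rw [e1, pow_succ]
    calc (∫ s, physFlux ε₀ α W (k₀ + ↑n + 1) s) ≤ r * ∫ s, physFlux ε₀ α W (k₀ + ↑n) s := hstep (k₀ + n)
      _ ≤ r * (r ^ n * ∫ s, physFlux ε₀ α W k₀ s) := mul_le_mul_of_nonneg_left ih hr0
      _ = r ^ n * r * ∫ s, physFlux ε₀ α W k₀ s := by ring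

/-- **NO SURVIVAL UNDER A WAKE BUDGET AND A RELATIVE BACKSCATTER BUDGET** (any `ν̂ ≥ 0`, no sign assumption).  A uniformly bounded
admissible eternal solution of a cancelling table at `ε₀ > 0` with per-shell actions `≤ M` and backscatter majorants
`b_j ≥ max(−F_j,0)` with `∫ b_j ≤ β·Φ_j` on every bond (`0 ≤ β < 1`) is NOT forward (S₁)-surviving as soon as
`(1+ε₀)·(ρ+β) < 1−β`, `ρ = 1 − e^{−κ}/(1+κ)`, `κ = 2C_AΛ⁻¹M`:  `(1+ε₀)ⁿE_n ≤ (1+β)e^{κ}·((1+ε₀)r)ⁿ·Φ_{−1} → 0`.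
[cite: Tao2016AveragedNS, §4 Lemma 4.1 (4.8)–(4.10) with (4.3) and the viscous equation before Thm. 4.2, §6.4; this file] -/
theorem not_survivingFwd_of_backscatterBudget (hε : 0 < ε₀) (hW : IsEternalVisc ε₀ νh α W) (hc : IsCancellingCoeff α)
    (hU : UniformBound W) {M : ℝ} (hM : ∀ n, ∫ s, ‖W n s‖ ≤ M)
    {b : ℤ → ℝ → ℝ} (cb : ∀ j, Continuous (b j)) (ib : ∀ j, Integrable (b j)) (hb0 : ∀ j s, 0 ≤ b j s)
    (hbF : ∀ j s, -physFlux ε₀ α W j s ≤ b j s) {β : ℝ} (hβ0 : 0 ≤ β) (hβ1 : β < 1)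
    (hB : ∀ j, ∫ s, b j s ≤ β * ∫ s, physFlux ε₀ α W j s)
    (hsmall : (1 + ε₀) * ((1 - Real.exp (-(2 * fluxConst α * (bigLam ε₀)⁻¹ * M))
      / (1 + 2 * fluxConst α * (bigLam ε₀)⁻¹ * M) + β)) < 1 - β) :
    ¬ EternalSurvivingFwd 1 ε₀ W := by
  set κ := 2 * fluxConst α * (bigLam ε₀)⁻¹ * M with hκ
  set ρ := 1 - Real.exp (-κ) / (1 + κ) with hρ
  have hκ₀nn : 0 ≤ 2 * fluxConst α * (bigLam ε₀)⁻¹ := by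
    have := fluxConst_nonneg α; have := (bigLam_pos (by linarith : (-1 : ℝ) < ε₀)).le; positivity
  have hM0 : 0 ≤ M := le_trans (integral_nonneg fun s => norm_nonneg (W 0 s)) (hM 0)
  have hκnn : 0 ≤ κ := by positivity
  have hρ0 : 0 ≤ ρ := (ratio_bounds hκnn).1
  have h1β : 0 < 1 - β := by linarith
  set r := (ρ + β) / (1 - β) with hr
  have hr0 : 0 ≤ r := div_nonneg (by linarith) h1β.le
  have hq0 : 0 ≤ (1 + ε₀) * r := by positivity
  have hq1 : (1 + ε₀) * r < 1 := by
    rw [hr, mul_div_assoc', div_lt_one h1β]; exact hsmall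
  -- net throughputs are non-negative (backscatter budget) and control the shell energies
  have hΦnn : ∀ j, 0 ≤ ∫ s, physFlux ε₀ α W j s := by
    intro j
    have hFj := integrable_physFlux hε hW hc hU j
    have h1 : -(∫ s, physFlux ε₀ α W j s) ≤ ∫ s, b j s := by
      rw [← integral_neg]; exact integral_mono hFj.neg (ib j) fun s => hbF j s
    nlinarith [hB j, (integral_nonneg (hb0 j)).trans (hB j)]
  have hEle : ∀ (k : ℤ) (σ : ℝ), physEnergy ε₀ W (k + 1) σ
      ≤ (1 + β) * Real.exp κ * ∫ s, physFlux ε₀ α W k s := by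
    intro k σ
    have hFk := integrable_physFlux hε hW hc hU k
    have hFk1 := integrable_physFlux hε hW hc hU (k + 1)
    obtain ⟨Mact, hMact⟩ := hW.action
    have hint2 : Integrable (fun s => ‖W (k + 2) s‖) := (hMact (k + 2)).1
    set x := ∫ s, physFlux ε₀ α W k s
    set y := ∫ s, physFlux ε₀ α W (k + 1) s
    set G : ℝ → ℝ := fun u => (∫ s in Iic u, physFlux ε₀ α W k s) - ∫ s in Iic u, physFlux ε₀ α W (k + 1) s
      with hG
    have hTG : Tendsto G atTop (𝓝 (x - y)) := (tendsto_integral_Iic_atTop hFk).sub (tendsto_integral_Iic_atTop hFk1)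
    have hret : ∀ σ', σ ≤ σ' → Real.exp (-κ) * G σ - β * x ≤ G σ' := by
      intro σ' hle
      refine heldEnergy_ge_retention_backscatter hε hW hc hU k hle (cb k) (hb0 k) (hbF k) ?_ ?_
      · rw [intervalIntegral.integral_const_mul]
        refine mul_le_mul_of_nonneg_left ?_ hκ₀nn
        rw [intervalIntegral.integral_of_le hle]
        exact (setIntegral_le_integral hint2 (Eventually.of_forall fun s => norm_nonneg _)).trans (hM (k + 2))
      · rw [intervalIntegral.integral_of_le hle]
        exact (setIntegral_le_integral (ib k) (Eventually.of_forall (hb0 k))).trans (hB k)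
    have hA : Real.exp (-κ) * G σ - β * x ≤ x - y :=
      ge_of_tendsto hTG (eventually_atTop.2 ⟨σ, fun σ' hσ => hret σ' hσ⟩)
    have eκ : Real.exp κ * Real.exp (-κ) = 1 := by rw [← Real.exp_add, add_neg_cancel, Real.exp_zero]
    have h1 : G σ ≤ Real.exp κ * (x - y + β * x) := by
      have h := mul_le_mul_of_nonneg_left (show Real.exp (-κ) * G σ ≤ x - y + β * x by linarith) (Real.exp_pos κ).le
      rwa [← mul_assoc, eκ, one_mul] at h
    have h2 : x - y + β * x ≤ (1 + β) * x := by nlinarith [hΦnn (k + 1)]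
    calc physEnergy ε₀ W (k + 1) σ ≤ G σ := physEnergy_le_heldEnergy hε hW hc hU k σ
      _ ≤ Real.exp κ * (x - y + β * x) := h1
      _ ≤ Real.exp κ * ((1 + β) * x) := mul_le_mul_of_nonneg_left h2 (Real.exp_pos κ).le
      _ = (1 + β) * Real.exp κ * x := by ring
  -- the chain from the bond `-1 → 0`
  set A₀ := (1 + β) * Real.exp κ * ∫ s, physFlux ε₀ α W (-1) s with hA₀
  have hA₀nn : 0 ≤ A₀ := by have := hΦnn (-1); positivity
  have hpow := throughput_le_pow_backscatter hε hW hc hU hM cb ib hb0 hbF hβ0 hβ1 hB (-1)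
  have hEn : ∀ (n : ℕ) (σ : ℝ), physEnergy ε₀ W n σ ≤ r ^ n * A₀ := by
    intro n σ
    have h1 := hEle (-1 + n) σ
    rw [show (-1 + (n : ℤ)) + 1 = n by ring] at h1
    have h2 := mul_le_mul_of_nonneg_left (hpow n) (by positivity : (0 : ℝ) ≤ (1 + β) * Real.exp κ)
    calc physEnergy ε₀ W n σ ≤ (1 + β) * Real.exp κ * ∫ s, physFlux ε₀ α W (-1 + n) s := h1
      _ ≤ (1 + β) * Real.exp κ * (r ^ n * ∫ s, physFlux ε₀ α W (-1) s) := h2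
      _ = r ^ n * A₀ := by rw [hA₀]; ring
  rintro ⟨c, hc0, hcN⟩
  obtain ⟨N, hN⟩ : ∃ N : ℕ, ((1 + ε₀) * r) ^ N * A₀ < c := by
    have ht : Tendsto (fun n : ℕ => ((1 + ε₀) * r) ^ n * A₀) atTop (𝓝 (0 * A₀)) :=
      (tendsto_pow_atTop_nhds_zero_of_lt_one hq0 hq1).mul_const A₀
    rw [zero_mul] at ht
    exact (ht.eventually (gt_mem_nhds hc0)).exists
  obtain ⟨n, hnN, σ, -, hcle⟩ := hcN N
  have hw : physWeight 1 ε₀ ^ n * (Real.exp (2 * σ) * ‖W n σ‖ ^ 2) = (1 + ε₀) ^ n * physEnergy ε₀ W n σ := by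
    have := wtEnergy_eq hε W n σ; unfold wtEnergy at this; exact this
  rw [hw] at hcle
  have hb' : (1 + ε₀) ^ n * physEnergy ε₀ W n σ ≤ ((1 + ε₀) * r) ^ n * A₀ := by
    calc (1 + ε₀) ^ n * physEnergy ε₀ W n σ ≤ (1 + ε₀) ^ n * (r ^ n * A₀) :=
          mul_le_mul_of_nonneg_left (hEn n σ) (by positivity)
      _ = ((1 + ε₀) * r) ^ n * A₀ := by rw [mul_pow]; ring
  have hmono : ((1 + ε₀) * r) ^ n * A₀ ≤ ((1 + ε₀) * r) ^ N * A₀ :=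
    mul_le_mul_of_nonneg_right (pow_le_pow_of_le_one hq0 hq1.le hnN) hA₀nn
  linarith

end Summit.NavierStokesRegularity.NavierStokesRegularity.Theorems.NoSurvivingEternalViscBddOne.UpwardFlux

end
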